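import Summits.QuantumFields.YangMills.Theorems.LuscherReductionTwistedTraceScalingBOBtCFloor
import Summits.QuantumFields.YangMills.Theorems.FlatTubeReductionCrossBoundNumerology
import Summits.QuantumFields.YangMills.Theorems.FemtoTransferGapRungW1upSite
import HarnessLib

/-!
# Bookkeeping for the core piece of `stub_hODpot_A`: the quasimode floor with a general rate, the β-power balance of the slow coefficients,
# the logarithmic one-site separation

Support file for the crux `NearFlatRatioLaw` (line `ratepack_v2`, stub `stub_hODpot_A`; successor steps (B)/(C) of
`Cruxes/NearFlatRatioLaw/Lines/ratepack-v7-moments-g18.md` §14; memo v8 (g19)).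

* §1 `btC_floor_of_quasimode_eta` — lane A's `…BOBtCFloor.btC_floor_of_quasimode` VERBATIM with the rate `β^{-1/5}` replaced by an arbitrary `η`:
  `(1 − η)·(c₁·S/I₀)·M₂^{γ,in} ≤ btC·K₁(1,1)` from the central quasimode `|T₁ − c₁M| ≤ η·c₁M` (input (2) of `…CoreCurrencyPot.core_currency_pot`).
* §2 ★ `slow_coeff_bound_phi`, `slow_coeff_bound_psi` — THE β-POWER BOOKKEEPING (B): the `‖φ‖²`- and `∫od²φ²`-coefficients of
  `…SlowSideFibreFactors.integral_outputWeight_mul_slow_side_le_fibre_factors`, weighted by the fibre-factor gains `β^{-2}`, `β^{-4}` of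
  `…RecordFibreFactor`, are `≤ C_φ·ℓ²·w` resp. `≤ C_ψ·ℓ²` (`ℓ = linkCE`, `w = β^{-2/3}`) once `m² ≤ c_m·w`, `CB ≤ c_cb·w·ℓ`, `d_O² ≤ D₂`, `c₂² ≤ 4K_N²β³`, `β⁻¹ ≤ w ≤ 1`
  (nine resp. four monomials; `C_φ`, `C_ψ` displayed, β-free).
* §3 `crossBound_log_le_linkCE` — at the one-site separation `m = √(39·log B/B)` (`κ = 13/2` in `…CrossBoundNumerology.crossBound_one_at_log`):
  `(4|E₁|)²·crossBound 1 B m ≤ 288000e³·B⁻²·linkCE B` (`λ₀(B) ≥ e^{6B}e^{-3}B^{-9/2}/2000`, `λ₀ ≤ linkCE`); `log_window_sq_le` — `m² ≤ 117·B^{-2/3}`.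
-/

set_option autoImplicit false

noncomputable section

open MeasureTheory Filter Topology Real
open scoped BigOperators
open Literature.MathematicalPhysics.QuantumFieldTheory
open Literature.MathematicalPhysics.QuantumLattice

namespace Summit.QuantumFields.YangMills.Theorems.FemtoTransferGap.TwoLattice.ConstTube

open Summit.QuantumFields.YangMills.Theorems.FemtoTransferGap
open Summit.QuantumFields.YangMills.Theorems.FemtoTransferGap.TwoLattice
open Summit.QuantumFields.YangMills.Theorems.FemtoTransferGap.TwoLattice.Avg
open Summit.QuantumFields.YangMills.Theorems.FemtoTransferGap.TwoLattice.Stiff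
open Summit.QuantumFields.YangMills.Theorems.FemtoTransferGap.TwoLattice.GnChart
open Summit.QuantumFields.YangMills.Theorems.FemtoTransferGap.TwoLattice.Cov

variable {L : ℕ} [NeZero L]

/-! ## §1 The (B-T) constant from below by a central quasimode with rate `η` -/

/-- ★ **`(1 − η)·(c₁S/I₀)·M₂^{γ,in} ≤ btC·K₁(1,1)`** from the central quasimode `|T₁(v') − c₁M(v')| ≤ η·c₁M(v')` on the inner core
(lane A's `btC_floor_of_quasimode` with `β^{-1/5}` replaced by `η`). [cite: Luscher1983, §3] -/
theorem btC_floor_of_quasimode_eta {β : ℝ} (hβ : 0 < β) {c₁ ηq : ℝ}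
    (hfloor : ∀ v' : Edge 3 L → Fin 3 → ℝ, v' ∈ capBalancedSet L →
      (∀ (e : Edge 3 L) (c : Fin 3), |v' e c| ≤ (9 * (L : ℝ) * (5 * (powScale (1 / 2) β * btLog β ^ 2)) + (powScale 1 β))) → ‖linkEmbed L v'‖ ≤ (min (1 / 40) (powScale (1 / 2) β * btLog β)) / 12 →
      |fpFibreTransfer L β (fun x : LinkSpace L => {x : LinkSpace L | linkCurry x ∈ capBalancedSet L}.indicator (fun _ => (1 : ℝ)) x *
            frozenProfile L (fun β' => stiffGaussExp L (β' / 2) β') (fun β' => min (1 / 40) (powScale (1 / 2) β' * btLog β')) β x)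
          (coreWeight L (powScale 1 β) (5 * (powScale (1 / 2) β * btLog β ^ 2))) (orthoTube L 1 v') 1 -
        c₁ * ((stiffGaussTop L (β / 2) β * Real.exp (-stiffGaussExp L (β / 2) β (linkEmbed L v'))) /
          (∫ u, ({u : GaugeConfig 3 1 SU2 | (∀ k : Fin 3, ‖su2Quat (u (0, k)) - 1‖ ≤ (powScale (1 / 3) β)) ∧ (L : ℝ) ^ 3 * wilsonAction su2Rep u ≤ (powScale (1 / 2) β)}.indicator (fun _ => (1 : ℝ))) u *
            (transferKernel su2Rep ((L : ℝ) ^ 3 * β) (1 : GaugeConfig 3 1 SU2) u / transferKernel su2Rep ((L : ℝ) ^ 3 * β) (1 : GaugeConfig 3 1 SU2) 1) ∂configMeasure SU2 1))| ≤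
        ηq * (c₁ * ((stiffGaussTop L (β / 2) β * Real.exp (-stiffGaussExp L (β / 2) β (linkEmbed L v'))) /
          (∫ u, ({u : GaugeConfig 3 1 SU2 | (∀ k : Fin 3, ‖su2Quat (u (0, k)) - 1‖ ≤ (powScale (1 / 3) β)) ∧ (L : ℝ) ^ 3 * wilsonAction su2Rep u ≤ (powScale (1 / 2) β)}.indicator (fun _ => (1 : ℝ))) u *
            (transferKernel su2Rep ((L : ℝ) ^ 3 * β) (1 : GaugeConfig 3 1 SU2) u / transferKernel su2Rep ((L : ℝ) ^ 3 * β) (1 : GaugeConfig 3 1 SU2) 1) ∂configMeasure SU2 1)))) :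
    (1 - ηq) *
        (c₁ * stiffGaussTop L (β / 2) β /
          (∫ u, ({u : GaugeConfig 3 1 SU2 | (∀ k : Fin 3, ‖su2Quat (u (0, k)) - 1‖ ≤ (powScale (1 / 3) β)) ∧ (L : ℝ) ^ 3 * wilsonAction su2Rep u ≤ (powScale (1 / 2) β)}.indicator (fun _ => (1 : ℝ))) u *
            (transferKernel su2Rep ((L : ℝ) ^ 3 * β) (1 : GaugeConfig 3 1 SU2) u / transferKernel su2Rep ((L : ℝ) ^ 3 * β) (1 : GaugeConfig 3 1 SU2) 1) ∂configMeasure SU2 1)) *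
        (∫ v, {v : Edge 3 L → Fin 3 → ℝ | ‖linkEmbed L v‖ ≤ min (1 / 40) (powScale (1 / 2) β * btLog β) / 12}.indicator (fun _ => (1 : ℝ)) v *
          (Real.exp (-(stiffGaussExp L (β / 2) β (linkEmbed L v))) ^ 2 * Real.exp (-(‖(gaugeModes L).starProjection (linkEmbed L v)‖ ^ 2 / powScale 1 β ^ 2))) ∂orthoTransverse L) ≤
      btC L β (fun x : LinkSpace L => {x : LinkSpace L | linkCurry x ∈ capBalancedSet L}.indicator (fun _ => (1 : ℝ)) x *
            frozenProfile L (fun β' => stiffGaussExp L (β' / 2) β') (fun β' => min (1 / 40) (powScale (1 / 2) β' * btLog β')) β x)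
          (powScale 1 β) (5 * (powScale (1 / 2) β * btLog β ^ 2)) *
        transferKernel su2Rep ((L : ℝ) ^ 3 * β) (1 : GaugeConfig 3 1 SU2) 1 := by
  haveI := isFiniteMeasure_orthoTransverse L
  -- abbreviations
  set S : ℝ := stiffGaussTop L (β / 2) β with hSdef
  set I₀ : ℝ := ∫ u, ({u : GaugeConfig 3 1 SU2 | (∀ k : Fin 3, ‖su2Quat (u (0, k)) - 1‖ ≤ (powScale (1 / 3) β)) ∧ (L : ℝ) ^ 3 * wilsonAction su2Rep u ≤ (powScale (1 / 2) β)}.indicator (fun _ => (1 : ℝ))) u *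
      (transferKernel su2Rep ((L : ℝ) ^ 3 * β) (1 : GaugeConfig 3 1 SU2) u / transferKernel su2Rep ((L : ℝ) ^ 3 * β) (1 : GaugeConfig 3 1 SU2) 1) ∂configMeasure SU2 1 with hIdef
  set rf : ℝ := min (1 / 40) (powScale (1 / 2) β * btLog β) with hrfdef
  set K₁ : ℝ := transferKernel su2Rep ((L : ℝ) ^ 3 * β) (1 : GaugeConfig 3 1 SU2) 1 with hK₁def
  have hK₁ : 0 < K₁ := transferKernel_pos _ _ _ _
  obtain ⟨hSlo, -⟩ := stiffGaussTop_record_bounds (L := L) hβ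
  have hS : 0 < S := lt_of_lt_of_le (pow_pos (Real.sqrt_pos.2 (by positivity)) _) hSlo
  have hI0 : 0 < I₀ := slowWindow_I0_pos (L := L) (powScale_pos (1 / 3) β) (powScale_pos (1 / 2) β) ((L : ℝ) ^ 3 * β)
  have hrf0 : 0 ≤ rf := le_min (by norm_num) (mul_nonneg (powScale_pos _ _).le (le_trans zero_le_one (one_le_btLog β)))
  -- the profile and weight data
  have hqfm : ∀ β', Measurable ((fun β'' : ℝ => stiffGaussExp L (β'' / 2) β'') β') := fun β' => measurable_stiffGaussExp _ _
  have hqf0 : ∀ β' x, 0 ≤ (fun β'' : ℝ => stiffGaussExp L (β'' / 2) β'') β' x := fun β' x => stiffGaussExp_nonneg _ _ x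
  have hΩGm : Measurable (frozenProfile L (fun β' => stiffGaussExp L (β' / 2) β') (fun β' => min (1 / 40) (powScale (1 / 2) β' * btLog β')) β) :=
    measurable_frozenProfile hqfm _ β
  have hΩG0 : ∀ x, 0 ≤ frozenProfile L (fun β' => stiffGaussExp L (β' / 2) β') (fun β' => min (1 / 40) (powScale (1 / 2) β' * btLog β')) β x :=
    fun x => (frozenProfile_mem_Icc hqf0 _ β x).1
  have hΩG1 : ∀ x, |frozenProfile L (fun β' => stiffGaussExp L (β' / 2) β') (fun β' => min (1 / 40) (powScale (1 / 2) β' * btLog β')) β x| ≤ 1 :=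
    abs_frozenProfile_le hqf0 _ β
  have hΩm := measurable_capRestrict (L := L) hΩGm
  have hΩdat := fun x => capRestrict_mem (L := L) hΩG0 hΩG1 x
  have hWm := measurable_coreWeight (L := L) (powScale 1 β) (5 * (powScale (1 / 2) β * btLog β ^ 2))
  -- the comparison function `A(v) = S·e^{−q(v̂)}/I₀`
  have hAm : Measurable fun v : Edge 3 L → Fin 3 → ℝ => S * Real.exp (-stiffGaussExp L (β / 2) β (linkEmbed L v)) / I₀ :=
    ((measurable_const.mul (((measurable_stiffGaussExp (L := L) (β / 2) β).comp (measurable_linkEmbed L)).neg.exp)).div_const I₀)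
  have hCA : ∀ v : Edge 3 L → Fin 3 → ℝ, |S * Real.exp (-stiffGaussExp L (β / 2) β (linkEmbed L v)) / I₀| ≤ S / I₀ := fun v => by
    rw [abs_of_nonneg (by positivity)]
    refine div_le_div_of_nonneg_right ?_ hI0.le
    have h1 : Real.exp (-stiffGaussExp L (β / 2) β (linkEmbed L v)) ≤ 1 := Real.exp_le_one_iff.mpr (by linarith [stiffGaussExp_nonneg (L := L) (β / 2) β (linkEmbed L v)])
    nlinarith [h1, hS]
  -- the inner set
  set Vin : Set (Edge 3 L → Fin 3 → ℝ) := {v | v ∈ capBalancedSet L ∧ ‖linkEmbed L v‖ ≤ rf / 12} with hVin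
  have hVinm : MeasurableSet Vin := (measurableSet_capBalancedSet L).inter (measurableSet_le (measurable_linkEmbed L).norm measurable_const)
  -- the quasimode floor on `Vin`
  have hlo : ∀ v ∈ Vin, (1 - ηq) * c₁ * (S * Real.exp (-stiffGaussExp L (β / 2) β (linkEmbed L v)) / I₀) ≤
      fpFibreTransfer L β (fun x : LinkSpace L => {x : LinkSpace L | linkCurry x ∈ capBalancedSet L}.indicator (fun _ => (1 : ℝ)) x *
          frozenProfile L (fun β' => stiffGaussExp L (β' / 2) β') (fun β' => min (1 / 40) (powScale (1 / 2) β' * btLog β')) β x)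
        (coreWeight L (powScale 1 β) (5 * (powScale (1 / 2) β * btLog β ^ 2))) (orthoTube L 1 v) 1 := by
    intro v hv
    obtain ⟨hvc, hvn⟩ := hv
    have hvT : ∀ (e : Edge 3 L) (c : Fin 3), |v e c| ≤ (9 * (L : ℝ) * (5 * (powScale (1 / 2) β * btLog β ^ 2)) + (powScale 1 β)) := fun e c => by
      have h1 : |v e c| ≤ ‖v e‖ := by
        have := norm_le_pi_norm (v e) c; rwa [Real.norm_eq_abs] at this
      have h2 : ‖v e‖ ≤ ‖linkEmbed L v‖ := norm_apply_le_norm_linkEmbed v e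
      have h3 : rf / 12 ≤ rf := by linarith
      exact h1.trans (h2.trans (hvn.trans (h3.trans (rf_le_schedT (L := L) β))))
    have h := hfloor v hvc hvT hvn
    have hM : S * Real.exp (-stiffGaussExp L (β / 2) β (linkEmbed L v)) / I₀ = (stiffGaussTop L (β / 2) β * Real.exp (-stiffGaussExp L (β / 2) β (linkEmbed L v))) / I₀ := rfl
    rw [hM]
    have h' := (abs_le.mp h).1
    nlinarith [h']
  have hq := fpBOKernel_one_one_ge_of_quasimode (L := L) β hΩm (fun x => (hΩdat x).2.2) (fun x => (hΩdat x).1) hWm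
    (abs_coreWeight_le (L := L) _ _) (fun g => (coreWeight_mem_Icc (L := L) _ _ g).1) hAm hCA hVinm hlo
  -- the integral on the left is `(S/I₀)·M₂^{γ,in}` (cap a.e.)
  have hcapπ : ∀ᵐ v ∂orthoTransverse L, v ∈ capBalancedSet L := by
    rw [ae_iff]; have h0 := orthoTransverse_compl_capBalancedSet L; simpa only [Set.compl_def] using h0
  have hI : ∫ v, Vin.indicator (fun _ => (1 : ℝ)) v *
        ((fun x : LinkSpace L => {x : LinkSpace L | linkCurry x ∈ capBalancedSet L}.indicator (fun _ => (1 : ℝ)) x *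
            frozenProfile L (fun β' => stiffGaussExp L (β' / 2) β') (fun β' => min (1 / 40) (powScale (1 / 2) β' * btLog β')) β x) (linkEmbed L v) *
          (S * Real.exp (-stiffGaussExp L (β / 2) β (linkEmbed L v)) / I₀)) ∂orthoTransverse L =
      S / I₀ * ∫ v, {v : Edge 3 L → Fin 3 → ℝ | ‖linkEmbed L v‖ ≤ rf / 12}.indicator (fun _ => (1 : ℝ)) v *
          (Real.exp (-(stiffGaussExp L (β / 2) β (linkEmbed L v))) ^ 2 * Real.exp (-(‖(gaugeModes L).starProjection (linkEmbed L v)‖ ^ 2 / powScale 1 β ^ 2))) ∂orthoTransverse L := by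
    rw [← integral_const_mul]
    refine integral_congr_ae ?_
    filter_upwards [hcapπ] with v hv
    by_cases hvn : ‖linkEmbed L v‖ ≤ rf / 12
    · have hVmem : v ∈ Vin := ⟨hv, hvn⟩
      rw [Set.indicator_of_mem hVmem, Set.indicator_of_mem (show v ∈ {v : Edge 3 L → Fin 3 → ℝ | ‖linkEmbed L v‖ ≤ rf / 12} from hvn),
        Set.indicator_of_mem ((linkEmbed_mem_capLink_iff v).2 hv)]
      unfold frozenProfile
      have hball : linkEmbed L v ∈ Metric.closedBall (0 : LinkSpace L) (min (1 / 40) (powScale (1 / 2) β * btLog β)) := by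
        rw [Metric.mem_closedBall, dist_zero_right]; rw [← hrfdef]; linarith
      rw [Set.indicator_of_mem hball]
      have e2 : Real.exp (-stiffGaussExp L (β / 2) β (linkEmbed L v)) ^ 2 = Real.exp (-stiffGaussExp L (β / 2) β (linkEmbed L v)) * Real.exp (-stiffGaussExp L (β / 2) β (linkEmbed L v)) := sq _
      rw [e2]
      field_simp
    · have hVmem : v ∉ Vin := fun h => hvn h.2
      rw [Set.indicator_of_notMem hVmem, Set.indicator_of_notMem (show v ∉ {v : Edge 3 L → Fin 3 → ℝ | ‖linkEmbed L v‖ ≤ rf / 12} from hvn)]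
      simp
  rw [hI] at hq
  -- `fpBOKernel(1,1) = btC·K₁`
  have hbt : fpBOKernel L β (fun x : LinkSpace L => {x : LinkSpace L | linkCurry x ∈ capBalancedSet L}.indicator (fun _ => (1 : ℝ)) x *
          frozenProfile L (fun β' => stiffGaussExp L (β' / 2) β') (fun β' => min (1 / 40) (powScale (1 / 2) β' * btLog β')) β x)
        (coreWeight L (powScale 1 β) (5 * (powScale (1 / 2) β * btLog β ^ 2))) 1 1 =
      btC L β (fun x : LinkSpace L => {x : LinkSpace L | linkCurry x ∈ capBalancedSet L}.indicator (fun _ => (1 : ℝ)) x *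
            frozenProfile L (fun β' => stiffGaussExp L (β' / 2) β') (fun β' => min (1 / 40) (powScale (1 / 2) β' * btLog β')) β x)
          (powScale 1 β) (5 * (powScale (1 / 2) β * btLog β ^ 2)) * K₁ := by
    unfold btC; rw [hK₁def, div_mul_cancel₀ _ hK₁.ne']
  rw [hbt] at hq
  have e : (1 - ηq) * (c₁ * S / I₀) *
      (∫ v, {v : Edge 3 L → Fin 3 → ℝ | ‖linkEmbed L v‖ ≤ rf / 12}.indicator (fun _ => (1 : ℝ)) v *
        (Real.exp (-(stiffGaussExp L (β / 2) β (linkEmbed L v))) ^ 2 * Real.exp (-(‖(gaugeModes L).starProjection (linkEmbed L v)‖ ^ 2 / powScale 1 β ^ 2))) ∂orthoTransverse L) =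
      (1 - ηq) * c₁ * (S / I₀ * ∫ v, {v : Edge 3 L → Fin 3 → ℝ | ‖linkEmbed L v‖ ≤ rf / 12}.indicator (fun _ => (1 : ℝ)) v *
        (Real.exp (-(stiffGaussExp L (β / 2) β (linkEmbed L v))) ^ 2 * Real.exp (-(‖(gaugeModes L).starProjection (linkEmbed L v)‖ ^ 2 / powScale 1 β ^ 2))) ∂orthoTransverse L) := by
    ring
  rw [e]
  exact hq


/-! ## §2 ★ The β-power bookkeeping of the slow coefficients -/

set_option maxHeartbeats 800000 in
-- a `ring` identity on the ~1 kB coefficient polynomial plus nine monomial bounds.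
/-- ★ **The `‖φ‖²`-coefficients carry a factor `w = β^{-2/3}`**: nine monomials. [folklore] -/
theorem slow_coeff_bound_phi {KN AL QG ℓ CB β m dO c₂ w ccb cm D2 : ℝ} (hβ : 1 ≤ β) (hℓ : 0 ≤ ℓ) (hCB0 : 0 ≤ CB) (hCB : CB ≤ ccb * w * ℓ) (hccb : 0 ≤ ccb)
    (hm : m ^ 2 ≤ cm * w) (hcm : 0 ≤ cm) (hdO : dO ^ 2 ≤ D2) (hD2 : 0 ≤ D2) (hw0 : 0 < w) (hw1 : w ≤ 1) (hβw : β⁻¹ ≤ w) (hc₂ : c₂ ^ 2 ≤ 4 * KN ^ 2 * β ^ 3) :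
    (2 * ((14 * (QG) ^ 2 * dO ^ 2 + 8 * (QG) ^ 2 * m ^ 2) * ℓ + 4 * (QG) ^ 2 * (CB)) * m ^ 2 * ℓ + ((14 * (QG) ^ 2 * dO ^ 2 + 8 * (QG) ^ 2 * m ^ 2) * ℓ + 4 * (QG) ^ 2 * (CB)) * (CB)) + (((3 * (KN) ^ 2 * β + 8 * ((KN) ^ 2 * β ^ 2 * (AL) ^ 2) * m ^ 2) * ℓ + 4 * ((KN) ^ 2 * β ^ 2 * (AL) ^ 2) * (CB) + 2 * (20 * ((KN) ^ 2 * β ^ 2 * (AL) ^ 2) * ℓ) * m ^ 2) * ℓ + (20 * ((KN) ^ 2 * β ^ 2 * (AL) ^ 2) * ℓ) * (CB)) * (β ^ 2)⁻¹ + (54 * c₂ ^ 2 * ℓ * ℓ) * (β ^ 4)⁻¹ +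
        2 * ((((KN) ^ 2 * β + 4 * ((KN) ^ 2 * β ^ 2 * (AL) ^ 2) * m ^ 2) * ℓ + 2 * ((KN) ^ 2 * β ^ 2 * (AL) ^ 2) * (CB) + 16 * ((KN) ^ 2 * β ^ 2 * (AL) ^ 2) * ℓ * m ^ 2) * ℓ + 8 * ((KN) ^ 2 * β ^ 2 * (AL) ^ 2) * ℓ * (CB)) * (β ^ 2)⁻¹ + 2 * (18 * c₂ ^ 2 * ℓ * ℓ) * (β ^ 4)⁻¹ ≤
      (44 * AL ^ 2 * KN ^ 2 * ccb + 88 * AL ^ 2 * KN ^ 2 * cm + 14 * QG ^ 2 * D2 * ccb + 16 * QG ^ 2 * ccb * cm + 4 * QG ^ 2 * ccb ^ 2 + 5 * KN ^ 2 +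
          28 * QG ^ 2 * D2 * cm + 16 * QG ^ 2 * cm ^ 2 + 360 * KN ^ 2) * ℓ ^ 2 * w := by
  have hβ0 : 0 < β := by linarith
  have hg2 : β ^ 2 * (β ^ 2)⁻¹ = 1 := mul_inv_cancel₀ (by positivity)
  have hg4 : β ^ 3 * (β ^ 4)⁻¹ = β⁻¹ := by field_simp
  have hg1 : β * (β ^ 2)⁻¹ = β⁻¹ := by field_simp
  have hm0 : 0 ≤ m ^ 2 := sq_nonneg _
  have hdO0 : 0 ≤ dO ^ 2 := sq_nonneg _
  have hw2 : w ^ 2 ≤ w := by nlinarith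
  have hAK : 0 ≤ AL ^ 2 * KN ^ 2 := by positivity
  have hQ : 0 ≤ QG ^ 2 := sq_nonneg _
  have hℓ2 : 0 ≤ ℓ ^ 2 := sq_nonneg _
  -- squared substitutes
  have hcm2 : (m ^ 2) ^ 2 ≤ cm ^ 2 * w := by
    have h1 : (m ^ 2) ^ 2 ≤ (cm * w) ^ 2 := pow_le_pow_left₀ hm0 hm 2
    have h2 : (cm * w) ^ 2 = cm ^ 2 * w ^ 2 := by ring
    have h3 : cm ^ 2 * w ^ 2 ≤ cm ^ 2 * w := mul_le_mul_of_nonneg_left hw2 (sq_nonneg _)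
    linarith
  have hCB2 : CB ^ 2 ≤ ccb ^ 2 * w * ℓ ^ 2 := by
    have h1 : CB ^ 2 ≤ (ccb * w * ℓ) ^ 2 := pow_le_pow_left₀ hCB0 hCB 2
    have h2 : (ccb * w * ℓ) ^ 2 = ccb ^ 2 * ℓ ^ 2 * w ^ 2 := by ring
    have h3 : ccb ^ 2 * ℓ ^ 2 * w ^ 2 ≤ ccb ^ 2 * ℓ ^ 2 * w := mul_le_mul_of_nonneg_left hw2 (by positivity)
    linarith
  have hCBℓ : CB * ℓ ≤ ccb * w * ℓ ^ 2 := by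
    have := mul_le_mul_of_nonneg_right hCB hℓ; linarith [show ccb * w * ℓ * ℓ = ccb * w * ℓ ^ 2 by ring]
  have hmw : m ^ 2 * w ≤ cm * w := by
    have h1 : m ^ 2 * w ≤ cm * w * w := mul_le_mul_of_nonneg_right hm hw0.le
    have h2 : cm * w * w ≤ cm * w := by nlinarith [mul_nonneg hcm (sub_nonneg.2 hw2)]
    linarith
  -- the nine monomials
  have t1 : 44 * AL ^ 2 * KN ^ 2 * CB * ℓ * (β ^ 2 * (β ^ 2)⁻¹) ≤ 44 * AL ^ 2 * KN ^ 2 * ccb * ℓ ^ 2 * w := by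
    rw [hg2, mul_one]
    have := mul_le_mul_of_nonneg_left hCBℓ (by positivity : (0 : ℝ) ≤ 44 * AL ^ 2 * KN ^ 2)
    linarith [show 44 * AL ^ 2 * KN ^ 2 * CB * ℓ = 44 * AL ^ 2 * KN ^ 2 * (CB * ℓ) by ring,
      show 44 * AL ^ 2 * KN ^ 2 * (ccb * w * ℓ ^ 2) = 44 * AL ^ 2 * KN ^ 2 * ccb * ℓ ^ 2 * w by ring]
  have t2 : 88 * AL ^ 2 * KN ^ 2 * ℓ ^ 2 * m ^ 2 * (β ^ 2 * (β ^ 2)⁻¹) ≤ 88 * AL ^ 2 * KN ^ 2 * cm * ℓ ^ 2 * w := by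
    rw [hg2, mul_one]
    have := mul_le_mul_of_nonneg_left hm (by positivity : (0 : ℝ) ≤ 88 * AL ^ 2 * KN ^ 2 * ℓ ^ 2)
    linarith [show 88 * AL ^ 2 * KN ^ 2 * ℓ ^ 2 * (cm * w) = 88 * AL ^ 2 * KN ^ 2 * cm * ℓ ^ 2 * w by ring]
  have t3 : 14 * CB * ℓ * QG ^ 2 * dO ^ 2 ≤ 14 * QG ^ 2 * D2 * ccb * ℓ ^ 2 * w := by
    have h1 : CB * ℓ * dO ^ 2 ≤ ccb * w * ℓ ^ 2 * D2 := mul_le_mul hCBℓ hdO hdO0 (by positivity)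
    have := mul_le_mul_of_nonneg_left h1 (by positivity : (0 : ℝ) ≤ 14 * QG ^ 2)
    linarith [show 14 * CB * ℓ * QG ^ 2 * dO ^ 2 = 14 * QG ^ 2 * (CB * ℓ * dO ^ 2) by ring,
      show 14 * QG ^ 2 * (ccb * w * ℓ ^ 2 * D2) = 14 * QG ^ 2 * D2 * ccb * ℓ ^ 2 * w by ring]
  have t4 : 16 * CB * ℓ * QG ^ 2 * m ^ 2 ≤ 16 * QG ^ 2 * ccb * cm * ℓ ^ 2 * w := by
    have h1 : CB * ℓ * m ^ 2 ≤ ccb * w * ℓ ^ 2 * m ^ 2 := mul_le_mul_of_nonneg_right hCBℓ hm0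
    have h2 : ccb * w * ℓ ^ 2 * m ^ 2 ≤ ccb * ℓ ^ 2 * (cm * w) := by
      have := mul_le_mul_of_nonneg_left hmw (by positivity : (0 : ℝ) ≤ ccb * ℓ ^ 2)
      linarith [show ccb * w * ℓ ^ 2 * m ^ 2 = ccb * ℓ ^ 2 * (m ^ 2 * w) by ring]
    have := mul_le_mul_of_nonneg_left (h1.trans h2) (by positivity : (0 : ℝ) ≤ 16 * QG ^ 2)
    linarith [show 16 * CB * ℓ * QG ^ 2 * m ^ 2 = 16 * QG ^ 2 * (CB * ℓ * m ^ 2) by ring,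
      show 16 * QG ^ 2 * (ccb * ℓ ^ 2 * (cm * w)) = 16 * QG ^ 2 * ccb * cm * ℓ ^ 2 * w by ring]
  have t5 : 4 * CB ^ 2 * QG ^ 2 ≤ 4 * QG ^ 2 * ccb ^ 2 * ℓ ^ 2 * w := by
    have := mul_le_mul_of_nonneg_left hCB2 (by positivity : (0 : ℝ) ≤ 4 * QG ^ 2)
    linarith [show 4 * CB ^ 2 * QG ^ 2 = 4 * QG ^ 2 * CB ^ 2 by ring, show 4 * QG ^ 2 * (ccb ^ 2 * w * ℓ ^ 2) = 4 * QG ^ 2 * ccb ^ 2 * ℓ ^ 2 * w by ring]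
  have t6 : 5 * KN ^ 2 * ℓ ^ 2 * (β * (β ^ 2)⁻¹) ≤ 5 * KN ^ 2 * ℓ ^ 2 * w := by
    rw [hg1]; exact mul_le_mul_of_nonneg_left hβw (by positivity)
  have t7 : 28 * ℓ ^ 2 * QG ^ 2 * dO ^ 2 * m ^ 2 ≤ 28 * QG ^ 2 * D2 * cm * ℓ ^ 2 * w := by
    have h1 : dO ^ 2 * m ^ 2 ≤ D2 * (cm * w) := mul_le_mul hdO hm hm0 hD2
    have := mul_le_mul_of_nonneg_left h1 (by positivity : (0 : ℝ) ≤ 28 * ℓ ^ 2 * QG ^ 2)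
    linarith [show 28 * ℓ ^ 2 * QG ^ 2 * dO ^ 2 * m ^ 2 = 28 * ℓ ^ 2 * QG ^ 2 * (dO ^ 2 * m ^ 2) by ring,
      show 28 * ℓ ^ 2 * QG ^ 2 * (D2 * (cm * w)) = 28 * QG ^ 2 * D2 * cm * ℓ ^ 2 * w by ring]
  have t8 : 16 * ℓ ^ 2 * QG ^ 2 * (m ^ 2) ^ 2 ≤ 16 * QG ^ 2 * cm ^ 2 * ℓ ^ 2 * w := by
    have := mul_le_mul_of_nonneg_left hcm2 (by positivity : (0 : ℝ) ≤ 16 * ℓ ^ 2 * QG ^ 2)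
    linarith [show 16 * ℓ ^ 2 * QG ^ 2 * (cm ^ 2 * w) = 16 * QG ^ 2 * cm ^ 2 * ℓ ^ 2 * w by ring]
  have t9 : 90 * ℓ ^ 2 * c₂ ^ 2 * (β ^ 4)⁻¹ ≤ 360 * KN ^ 2 * ℓ ^ 2 * w := by
    have h1 : c₂ ^ 2 * (β ^ 4)⁻¹ ≤ 4 * KN ^ 2 * β ^ 3 * (β ^ 4)⁻¹ := mul_le_mul_of_nonneg_right hc₂ (by positivity)
    rw [mul_assoc (4 * KN ^ 2), hg4] at h1
    have h2 : c₂ ^ 2 * (β ^ 4)⁻¹ ≤ 4 * KN ^ 2 * w := h1.trans (mul_le_mul_of_nonneg_left hβw (by positivity))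
    have := mul_le_mul_of_nonneg_left h2 (by positivity : (0 : ℝ) ≤ 90 * ℓ ^ 2)
    linarith [show 90 * ℓ ^ 2 * c₂ ^ 2 * (β ^ 4)⁻¹ = 90 * ℓ ^ 2 * (c₂ ^ 2 * (β ^ 4)⁻¹) by ring,
      show 90 * ℓ ^ 2 * (4 * KN ^ 2 * w) = 360 * KN ^ 2 * ℓ ^ 2 * w by ring]
  have e : (2 * ((14 * (QG) ^ 2 * dO ^ 2 + 8 * (QG) ^ 2 * m ^ 2) * ℓ + 4 * (QG) ^ 2 * (CB)) * m ^ 2 * ℓ + ((14 * (QG) ^ 2 * dO ^ 2 + 8 * (QG) ^ 2 * m ^ 2) * ℓ + 4 * (QG) ^ 2 * (CB)) * (CB)) + (((3 * (KN) ^ 2 * β + 8 * ((KN) ^ 2 * β ^ 2 * (AL) ^ 2) * m ^ 2) * ℓ + 4 * ((KN) ^ 2 * β ^ 2 * (AL) ^ 2) * (CB) + 2 * (20 * ((KN) ^ 2 * β ^ 2 * (AL) ^ 2) * ℓ) * m ^ 2) * ℓ + (20 * ((KN) ^ 2 * β ^ 2 * (AL) ^ 2) * ℓ) * (CB)) * (β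 ^ 2)⁻¹ + (54 * c₂ ^ 2 * ℓ * ℓ) * (β ^ 4)⁻¹ +
        2 * ((((KN) ^ 2 * β + 4 * ((KN) ^ 2 * β ^ 2 * (AL) ^ 2) * m ^ 2) * ℓ + 2 * ((KN) ^ 2 * β ^ 2 * (AL) ^ 2) * (CB) + 16 * ((KN) ^ 2 * β ^ 2 * (AL) ^ 2) * ℓ * m ^ 2) * ℓ + 8 * ((KN) ^ 2 * β ^ 2 * (AL) ^ 2) * ℓ * (CB)) * (β ^ 2)⁻¹ + 2 * (18 * c₂ ^ 2 * ℓ * ℓ) * (β ^ 4)⁻¹ =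
      44 * AL ^ 2 * KN ^ 2 * CB * ℓ * (β ^ 2 * (β ^ 2)⁻¹) + 88 * AL ^ 2 * KN ^ 2 * ℓ ^ 2 * m ^ 2 * (β ^ 2 * (β ^ 2)⁻¹) + 14 * CB * ℓ * QG ^ 2 * dO ^ 2 +
        16 * CB * ℓ * QG ^ 2 * m ^ 2 + 4 * CB ^ 2 * QG ^ 2 + 5 * KN ^ 2 * ℓ ^ 2 * (β * (β ^ 2)⁻¹) + 28 * ℓ ^ 2 * QG ^ 2 * dO ^ 2 * m ^ 2 +
        16 * ℓ ^ 2 * QG ^ 2 * (m ^ 2) ^ 2 + 90 * ℓ ^ 2 * c₂ ^ 2 * (β ^ 4)⁻¹ := by ring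
  rw [e]
  linarith [t1, t2, t3, t4, t5, t6, t7, t8, t9]

/-- ★ **The `∫od²φ²`-coefficients are `O(1)·ℓ²`**: four monomials. [folklore] -/
theorem slow_coeff_bound_psi {KN AL QG ℓ CB β m dO w ccb cm D2 : ℝ} (hβ : 1 ≤ β) (hℓ : 0 ≤ ℓ) (hCB : CB ≤ ccb * w * ℓ) (hccb : 0 ≤ ccb)
    (hm : m ^ 2 ≤ cm * w) (hcm : 0 ≤ cm) (hdO : dO ^ 2 ≤ D2) (hw1 : w ≤ 1) :
    (2 * ((14 * (QG) ^ 2 * dO ^ 2 + 8 * (QG) ^ 2 * m ^ 2) * ℓ + 4 * (QG) ^ 2 * (CB)) * ℓ) + (2 * (20 * ((KN) ^ 2 * β ^ 2 * (AL) ^ 2) * ℓ) * ℓ) * (β ^ 2)⁻¹ + 2 * (16 * ((KN) ^ 2 * β ^ 2 * (AL) ^ 2) * ℓ * ℓ) * (β ^ 2)⁻¹ ≤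
      (72 * AL ^ 2 * KN ^ 2 + 8 * QG ^ 2 * ccb + 28 * QG ^ 2 * D2 + 16 * QG ^ 2 * cm) * ℓ ^ 2 := by
  have hβ0 : 0 < β := by linarith
  have hg2 : β ^ 2 * (β ^ 2)⁻¹ = 1 := mul_inv_cancel₀ (by positivity)
  have t1 : 72 * AL ^ 2 * KN ^ 2 * ℓ ^ 2 * (β ^ 2 * (β ^ 2)⁻¹) ≤ 72 * AL ^ 2 * KN ^ 2 * ℓ ^ 2 := by rw [hg2, mul_one]
  have t2 : 8 * CB * ℓ * QG ^ 2 ≤ 8 * QG ^ 2 * ccb * ℓ ^ 2 := by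
    have h1 : CB * ℓ ≤ ccb * w * ℓ * ℓ := mul_le_mul_of_nonneg_right hCB hℓ
    have h2 : ccb * w * ℓ * ℓ ≤ ccb * ℓ ^ 2 := by
      have := mul_le_mul_of_nonneg_left hw1 (by positivity : (0 : ℝ) ≤ ccb * ℓ ^ 2)
      linarith [show ccb * w * ℓ * ℓ = ccb * ℓ ^ 2 * w by ring]
    have := mul_le_mul_of_nonneg_left (h1.trans h2) (by positivity : (0 : ℝ) ≤ 8 * QG ^ 2)
    linarith [show 8 * CB * ℓ * QG ^ 2 = 8 * QG ^ 2 * (CB * ℓ) by ring, show 8 * QG ^ 2 * (ccb * ℓ ^ 2) = 8 * QG ^ 2 * ccb * ℓ ^ 2 by ring]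
  have t3 : 28 * ℓ ^ 2 * QG ^ 2 * dO ^ 2 ≤ 28 * QG ^ 2 * D2 * ℓ ^ 2 := by
    have := mul_le_mul_of_nonneg_left hdO (by positivity : (0 : ℝ) ≤ 28 * ℓ ^ 2 * QG ^ 2)
    linarith [show 28 * ℓ ^ 2 * QG ^ 2 * D2 = 28 * QG ^ 2 * D2 * ℓ ^ 2 by ring]
  have t4 : 16 * ℓ ^ 2 * QG ^ 2 * m ^ 2 ≤ 16 * QG ^ 2 * cm * ℓ ^ 2 := by
    have h1 : m ^ 2 ≤ cm := by
      have := mul_le_mul_of_nonneg_left hw1 hcm; linarith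
    have := mul_le_mul_of_nonneg_left h1 (by positivity : (0 : ℝ) ≤ 16 * ℓ ^ 2 * QG ^ 2)
    linarith [show 16 * ℓ ^ 2 * QG ^ 2 * cm = 16 * QG ^ 2 * cm * ℓ ^ 2 by ring]
  have e : (2 * ((14 * (QG) ^ 2 * dO ^ 2 + 8 * (QG) ^ 2 * m ^ 2) * ℓ + 4 * (QG) ^ 2 * (CB)) * ℓ) + (2 * (20 * ((KN) ^ 2 * β ^ 2 * (AL) ^ 2) * ℓ) * ℓ) * (β ^ 2)⁻¹ + 2 * (16 * ((KN) ^ 2 * β ^ 2 * (AL) ^ 2) * ℓ * ℓ) * (β ^ 2)⁻¹ =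
      72 * AL ^ 2 * KN ^ 2 * ℓ ^ 2 * (β ^ 2 * (β ^ 2)⁻¹) + 8 * CB * ℓ * QG ^ 2 + 28 * ℓ ^ 2 * QG ^ 2 * dO ^ 2 + 16 * ℓ ^ 2 * QG ^ 2 * m ^ 2 := by ring
  rw [e]
  linarith [t1, t2, t3, t4]

/-! ## §3 The logarithmic one-site separation -/

/-- ★ **At `m = √(39·log B/B)`**: `(4|E₁|)²·crossBound 1 B m ≤ 288000·e³·B⁻²·linkCE B` for `B ≥ max 1 (2/rStar³)`. [folklore] -/
theorem crossBound_log_le_linkCE {B : ℝ} (hB1 : 1 ≤ B) (hB2 : 2 / rStar ^ 3 ≤ B) :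
    (4 * (Fintype.card (Edge 3 1) : ℝ)) ^ 2 * crossBound 1 B (Real.sqrt (39 * Real.log B / B)) ≤ 288000 * Real.exp 3 * B ^ (-(2 : ℝ)) * linkCE B := by
  have hB0 : 0 < B := by linarith
  have hE : (Fintype.card (Edge 3 1) : ℝ) = 3 := by rw [card_edge_three]; norm_num
  have hm : Real.sqrt (39 * Real.log B / B) = Real.sqrt (6 * (13 / 2) * Real.log B / B) := by norm_num
  rw [hE, hm, crossBound_one_at_log hB1 (by norm_num : (0 : ℝ) ≤ 13 / 2)]
  have hlam := levelValue_one_site_zero_ge hB1 hB2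
  rw [levelValue_zero] at hlam
  have hCE := topValue_le_linkCE hB0.le
  have hsplit : B ^ (-(13 / 2 : ℝ)) = B ^ (-(9 : ℝ) / 2) * B ^ (-(2 : ℝ)) := by
    rw [← Real.rpow_add hB0]; norm_num
  have hkey : Real.exp (6 * B) * B ^ (-(13 / 2 : ℝ)) = (2000 * Real.exp 3 * B ^ (-(2 : ℝ))) * (Real.exp (6 * B) * (Real.exp (-3) * B ^ (-(9 : ℝ) / 2) / 2000)) := by
    rw [hsplit]
    have e3 : Real.exp 3 * Real.exp (-3) = 1 := by rw [← Real.exp_add]; norm_num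
    field_simp
    nlinarith [e3, Real.exp_pos (6 * B), Real.rpow_pos_of_pos hB0 (-(9:ℝ)/2), Real.rpow_pos_of_pos hB0 (-(2:ℝ))]
  rw [hkey]
  have hpre : 0 ≤ 2000 * Real.exp 3 * B ^ (-(2 : ℝ)) := by positivity
  calc (4 * (3 : ℝ)) ^ 2 * ((2000 * Real.exp 3 * B ^ (-(2 : ℝ))) * (Real.exp (6 * B) * (Real.exp (-3) * B ^ (-(9 : ℝ) / 2) / 2000)))
      ≤ (4 * (3 : ℝ)) ^ 2 * ((2000 * Real.exp 3 * B ^ (-(2 : ℝ))) * linkCE B) := by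
        refine mul_le_mul_of_nonneg_left (mul_le_mul_of_nonneg_left (hlam.trans hCE) hpre) (by norm_num)
    _ = 288000 * Real.exp 3 * B ^ (-(2 : ℝ)) * linkCE B := by ring

/-- `m² = 39·log B/B ≤ 117·B^{-2/3}` for `B ≥ 1` (`log B ≤ 3B^{1/3}`). [folklore] -/
theorem log_window_sq_le {B : ℝ} (hB1 : 1 ≤ B) : Real.sqrt (39 * Real.log B / B) ^ 2 ≤ 117 * B ^ (-(2 / 3 : ℝ)) := by
  have hB0 : 0 < B := by linarith
  have hlog0 : 0 ≤ Real.log B := Real.log_nonneg hB1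
  rw [Real.sq_sqrt (by positivity)]
  have h := Real.log_le_rpow_div hB0.le (by norm_num : (0 : ℝ) < 1 / 3)
  have e : B ^ (-(2 / 3 : ℝ)) = B ^ (1 / 3 : ℝ) / B := by
    rw [show (-(2 / 3 : ℝ)) = 1 / 3 - 1 by norm_num, Real.rpow_sub_one hB0.ne']
  rw [e, div_le_iff₀ hB0]
  have : 117 * (B ^ (1 / 3 : ℝ) / B) * B = 117 * B ^ (1 / 3 : ℝ) := by field_simp
  rw [this]
  linarith

end Summit.QuantumFields.YangMills.Theorems.FemtoTransferGap.TwoLattice.ConstTube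

end
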